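import Mathlib
import Literature.Computability.AlgebraicComplexity.StandardFamilies
import Summits.ValiantsHypothesis.ValiantsHypothesis.Theses.RefutationDegree
import Summits.ValiantsHypothesis.ValiantsHypothesis.Theorems.RefutationDegreeDefs
import Summits.ValiantsHypothesis.ValiantsHypothesis.Theorems.RefutationDegreeRefutationBarrierStubSosPaddingMono
import Summits.ValiantsHypothesis.ValiantsHypothesis.Theorems.RefutationDegreeRefutationBarrierStubHasSosRefOfHasNsRef
import Summits.ValiantsHypothesis.ValiantsHypothesis.Theorems.RefutationDegreeRefutationBarrierStubNotHasSosRefOfContactSeq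

/-!
# Skeleton — crux `RefutationDegree.RefutationBarrier` (stmt-ValiantsHypothesis-5642), line `Sketch-ideator1`
(idea `arc-contact-exponent`), lead prover-line-stmt-ValiantsHypothesis-5642-0, gen 1.

Composition (`RefutationBarrier_of`): for every `c`, take `n₀` from C⁺ (`stub_contactQP`: super-polynomial
arc contact at the quadratic size `m₁ = ⌊n²/2⌋+1`); for `n ≥ n₀` and `m ≥ m₁`, a degree-`n^c`
Hermitian-SOS refutation of Rep(n,m) restricts along the padding `A ↦ A ⊕ [1]` to one of Rep(n,m₁)
(`stub_sosPaddingMono`, iterated in `hasSosRef_anti`), which the contact sequence kills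
(`stub_notHasSosRef_of_contactSeq`: evaluate at conjugate points, squares are `≥ 0`, the ideal part is
`o(1)` by degree bookkeeping, `1 ≤ o(1)`).  Stubs: T0 = `stub_sosPaddingMono` (LANDED p104509),
T1 = `stub_notHasSosRef_of_contactSeq` (LANDED p111207),
C⁺ = `stub_contactQP` (OPEN — the transfer target; by the card's (C2) it implies quadratic affine border
complexity of per_n and is expected false; the lead holds it); obstruction side: NsToSos =
`stub_hasSosRef_of_hasNsRef` (LANDED p102978), T2 reshaped to its conditional-on-Skoda–Brownawell form and
PROVED in `Theorems/RefutationDegreeRefutationBarrierConverse.lean`.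
Unconditional by-product (lead, LANDED p111271): `refutationBarrier_large` — the half `m > n^c` of every
instance holds by degree grading (`Theorems/RefutationDegreeRefutationBarrierGrading.lean`).
The crux is matched BY NAME through `refutationBarrier_iff … := Iff.rfl` (Defs file).
-/

-- `Summit.ValiantsHypothesis.ValiantsHypothesis.…` is the tree's mandated single-conjunct layout
-- (Sub = Summit), so the duplicated namespace component is intended.
set_option linter.dupNamespace false

noncomputable section

namespace Summit.ValiantsHypothesis.ValiantsHypothesis.Theorems.RefutationDegree

open scoped BigOperators
open Filter Topology MvPolynomial
open Literature.Computability.AlgebraicComplexity (perPoly)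
open Summit.ValiantsHypothesis.ValiantsHypothesis.Theses.RefutationDegree

/-! ### Stubs -/

-- STUB T0 `stub_sosPaddingMono (n m D : ℕ) : HasSosRef n (m + 1) D → HasSosRef n m D` —
-- LANDED p104509 (`Theorems/RefutationDegreeRefutationBarrierStubSosPaddingMono.lean`, imported).

-- STUB T1 `stub_notHasSosRef_of_contactSeq (n m D : ℕ) : ContactSeq n m D → ¬ HasSosRef n m D` —
-- LANDED p111207 (`Theorems/RefutationDegreeRefutationBarrierStubNotHasSosRefOfContactSeq.lean`, imported).

/-- STUB C⁺ (the transfer target `ContactQP`, OPEN): super-polynomial arc contact at the quadratic size —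
for every `c`, eventually in `n`, Rep(n, ⌊n²/2⌋+1) has asymptotic pseudo-solutions of contact `n^c`.
Implies affine border membership of per_n at size ⌊n²/2⌋+1 (LMR13 sharp up to +1); expected FALSE
(card `arc-contact-exponent`, (C2)); held by the lead, attacked by the disprover. -/
theorem stub_contactQP : ∀ c : ℕ, ∃ n₀ : ℕ, ∀ n ≥ n₀, ContactSeq n (n ^ 2 / 2 + 1) (n ^ c) := by
  sorry

/-! ### Composition -/

/-- Padding, iterated: refutations descend from size `m` to every smaller size `m₁ ≤ m`. -/
theorem hasSosRef_anti (n : ℕ) {m₁ m : ℕ} (D : ℕ) (hle : m₁ ≤ m) :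
    HasSosRef n m D → HasSosRef n m₁ D := by
  induction hle with
  | refl => exact id
  | step _ ih => exact fun hs => ih (stub_sosPaddingMono _ _ _ hs)

/-- COMPOSITION: C⁺ ⟹ the crux, BY NAME (two lines: arcs kill SOS at `m₁ = ⌊n²/2⌋+1`, padding carries
it to every `m ≥ m₁`). -/
theorem RefutationBarrier_of : RefutationBarrier := by
  rw [refutationBarrier_iff]
  intro c
  obtain ⟨n₀, hn₀⟩ := stub_contactQP c
  refine ⟨n₀, fun n hn m hm hsos => ?_⟩
  exact stub_notHasSosRef_of_contactSeq _ _ _ (hn₀ n hn) (hasSosRef_anti n (n ^ c) hm hsos)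

/-! ### Obstruction side (what the crux FORCES) — proved elsewhere, modulo Skoda–Brownawell

Not in the cone of `RefutationBarrier_of`.  The former stub T2 (`stub_hasNsRef_of_not_inBorder`,
Briançon–Skoda dichotomy) is RESHAPED to its conditional form and PROVED in
`Theorems/RefutationDegreeRefutationBarrierConverse.lean` (lead; LANDED p105398):
`hasNsRef_of_not_inBorder (hSB : skodaBrownawellDegreeBound …) : ¬ InBorder n m → HasNsRef n m ((n^2+1)*m^3+m)`,
together with `inBorder_of_refutationBarrier` / `mem_orbitClosure_of_refutationBarrier` (crux ⟹ cofinitely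
`\overline{dc}(per_n) ≤ ⌊n²/2⌋+1`, mod SB) and `not_refutationBarrier_of_io_notMem_orbitClosure`
("LMR13 + 2 infinitely often" refutes the crux, mod SB); `not_refutationBarrier_of_mulmuleySohoni`
(`…FalseOfMulmuleySohoni.lean`, p111352: Mulmuley–Sohoni ∧ SB ⟹ ¬crux); and the LOSSLESSNESS of the
transfer, `contactQP_of_refutationBarrier` (`…ContactOfBarrier.lean`, p111414: crux ⟹ `stub_contactQP`,
mod SB), packaged with this file's composition as `refutationBarrier_iff_contactQP` in
`…OfContactQP.lean`.  The UNCONDITIONAL half of the crux (`m > n^c`, degree grading) is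
`refutationBarrier_large` in `Theorems/RefutationDegreeRefutationBarrierGrading.lean` (p111271). -/

end Summit.ValiantsHypothesis.ValiantsHypothesis.Theorems.RefutationDegree

end
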